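/-
Copyright (c) 2026. All rights reserved.
Released under Apache 2.0 license as described in the file LICENSE.
-/
import Literature.AlgebraicGeometry.Pohlmann1968.AbelianCMFieldSurvivorTernaryCriterion
import Literature.NumberTheory.ComplexMultiplication.DegenerateCMTypesAbelianSurvivorCosets
import Literature.NumberTheory.ComplexMultiplication.DegenerateCMTypesAbelianSurvivorGaloisAction
import HarnessLib

/-!
# Abelian CM fields: `B = D` on `A` iff Kubota's survivors form a coset in the character group of `Gal(K/ℚ)`;
# Galois-conjugate and odd-multiple tests for exceptional Hodge classes

SETTING.  `K` an ABELIAN CM field, `G = Gal(K/ℚ)`, `ρ = conjGal`, `φ₀ : K → ℂ` a base embedding, `Φ` a CM type read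
on `G` as `T = {g : σ_g ∈ Φ}` (tree `embOf`), `Ŝ(χ) = Σ_{t ∈ T} χ(t)`, `S(Φ) = {χ : χ(ρ) = −1, Ŝ(χ) ≠ 0}` the
SURVIVORS, `Rank(Φ) = 1 + #S(Φ)` (T. Kubota [Kubota1965] §4 Lemma 2 = B. B. Gordon [Gordon1999HodgeAVSurvey] Prop.
9.4.1; tree `cmTypeRank_eq_typeRank_gal`).  The tree decides `Bᵐ(A) ⊗ ℂ = Dᵐ(A) ⊗ ℂ ∀ m` on an abelian variety
`A` of type `(K; Φ)` by the ternary closure of `S(Φ)` (g40-#6) and knows at the group level that ternary closure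
means «`S` is a coset of a subgroup of `Ĝ`» (g40-#7) and that `S` is stable under the Galois action `χ ↦ a • χ`,
`(a, |G|) = 1`, with `φ(ord χ)` survivors per survivor (g40-#8).  THIS FILE reads these on the field side:

> **Theorem** (`forall_hodgeClassSpan_eq_iff_exists_addSubgroup`).  `K` abelian CM, `Φ` ANY CM type, `A` ANY abelian
> variety of type `(K; Φ)`: **`Bᵐ(A) ⊗ ℂ = Dᵐ(A) ⊗ ℂ` for all `m` iff the survivors form a coset `χ₀ + E` of a
> subgroup `E` of the character group of `Gal(K/ℚ)`**; then `Rank(Φ) − 1 = |E|`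
> (`cmTypeRank_sub_one_eq_natCard_of_forall_mem_iff_sub_mem`).
> **Theorem** (`exists_exceptional_of_nsmul_sum_eq_zero`).  A survivor `χ` with an annihilated ODD multiple
> (`Σ_{t ∈ T} ((2k+1) • χ)(t) = 0`) produces an exceptional Hodge class on `A`.
> **Theorem** (`one_add_totient_addOrderOf_le_cmTypeRank`, `nsmul_mem_survivors_iff`).  `Rank(Φ) ≥ 1 + φ(ord χ)`
> for every survivor `χ`; the survivors are stable under `χ ↦ a • χ` for `a` coprime to `[K:ℚ]`.

* §1 **`forall_hodgeClassSpan_eq_iff_exists_addSubgroup`**, `forall_hodgeClassSpan_eq_iff_forall_mem_iff_sub_mem`,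
  **`cmTypeRank_sub_one_eq_natCard_of_forall_mem_iff_sub_mem`**, `hodgeConjectureFor_pow_of_forall_mem_iff_sub_mem`.
* §2 **`exists_exceptional_of_nsmul_sum_eq_zero`**, **`nsmul_mem_survivors_iff`**,
  **`one_add_totient_addOrderOf_le_cmTypeRank`**.
(The dictionary — the type read on `Gal(K/ℚ)` is a CM type for `conjGal` with the same rank — is the tree's
`CyclicTwoOddPrimes.isCMTypeWith_galType` / `cmTypeRank_eq_typeRank_galType` with `AbelianCMFieldExistence.apply_conjGal_eq`;
`Rank ≥ 2` is the tree's `two_le_cmTypeRank_complex`.)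

HONEST SCOPE.  Dictionary + assembly (g39-#11, g40-#6, g40-#7, g40-#8); abelian `K` only.  The sources print
Kubota's formula, the primitive criterion and the Galois invariance of the rank; the coset and Galois-orbit forms
are this file's packaging, not numbered statements of the sources.  THEOREMS ONLY: no definition, no named fact, no
instance, no `sorry`.

## References

* [Kubota1965] T. Kubota, *On the field extension by complex multiplication*, Trans. AMS 118 (1965), §2, §4 Lemma 2.
* [Pohlmann1968] H. Pohlmann, *Algebraic cycles on abelian varieties of complex multiplication type*, Ann. of Math. 88
  (1968), Thm. 1, §3.
* [White1993SporadicCycles] S. P. White, *Sporadic cycles on CM abelian varieties*, Compositio Math. 88 (1993), §4 Thm. 3.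
* [Gordon1999HodgeAVSurvey] B. B. Gordon, *A survey of the Hodge conjecture for abelian varieties*, Thm. 6.4, §9.2–9.3,
  Prop. 9.4.1, §9.4.2.
* [Ribet1980] K. A. Ribet, *Division fields of abelian varieties with complex multiplication*, Mém. SMF 2 (1980), §3.
* [Dodson1984] B. Dodson, *The structure of Galois groups of CM-fields*, Trans. AMS 283 (1984), §3.1.1.
* [Shimura1998] G. Shimura, *Abelian Varieties with Complex Multiplication and Modular Functions*, §8.4 Example (1),
  §18.2 Lemma (i).

## Provenance

Lane `lit-hodgefound` (Track 2, Layer A5), seat `lit-hodgefound-p10` generation 40, row g40-#9; neighbours cited by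
name, nothing restated: `DegenerateCMTypesAbelianSurvivorCosets` (g40-#7:
`two_mul_card_stabilizer_mul_eq_iff_exists_addSubgroup`, `two_mul_card_stabilizer_mul_eq_iff_forall_mem_iff_sub_mem`,
`typeRank_sub_one_eq_natCard_of_forall_mem_iff_sub_mem`), `DegenerateCMTypesAbelianSurvivorGaloisAction`
(g40-#8: `two_mul_card_stabilizer_mul_lt_of_nsmul_sum_eq_zero`, `nsmul_mem_survivors_iff`,
`one_add_totient_addOrderOf_le_typeRank`), `AbelianCMFieldSurvivorTernaryCriterion` (g40-#6:
`two_mul_card_stabilizer_mul_eq_iff_two_mul_natCard_twistStabilizer_mul_eq`), `AbelianCMFieldStabilizerCharacterCriterion`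
(g39-#11: `two_mul_card_stabilizer_mul_eq_iff_forall_hodgeClassSpan_eq`), `AbelianCMFieldStabilizerExceptionalClasses`
(g39-#9), `CMTypeRankStabilizerBound` (g39-#7), `DegenerateCMTypesCyclicCMFieldTwoOddPrimes`
(`CyclicTwoOddPrimes.isCMTypeWith_galType`, `cmTypeRank_eq_typeRank_galType`), `NondegenerateCMTypeExistenceAbelianField`
(`AbelianCMFieldExistence.apply_conjGal_eq`), `SimpleDegenerateCMAbelianVarietiesCompositeDimension` (`card_gal_eq_finrank`),
`CMTypeRankCharactersNumberField` (`embOf`).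
-/

open scoped BigOperators NumberField IsMulCommutative Classical
open NumberField Module CategoryTheory CategoryTheory.Limits IntermediateField

namespace Literature.AlgebraicGeometry.Pohlmann1968

open scoped Literature.NumberTheory.ComplexMultiplication
open Literature.NumberTheory.ComplexMultiplication (twistStabilizer typeRank IsCMTypeWith conjGal)
open Literature.AlgebraicGeometry.Pohlmann1968.CyclicTwoOddPrimes (isCMTypeWith_galType cmTypeRank_eq_typeRank_galType)
open Literature.NumberTheory.ComplexMultiplication.CyclicCMType.AbelianStabilizer
  (two_mul_card_stabilizer_mul_eq_iff_exists_addSubgroup two_mul_card_stabilizer_mul_eq_iff_forall_mem_iff_sub_mem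
  typeRank_sub_one_eq_natCard_of_forall_mem_iff_sub_mem two_mul_card_stabilizer_mul_lt_of_nsmul_sum_eq_zero
  one_add_totient_addOrderOf_le_typeRank)
open Literature.AlgebraicGeometry.Motives (CMType AbelianVariety)
open Literature.AlgebraicGeometry.HodgeTheory
open Literature.AlgebraicGeometry.VanGeemen1994 (hodgeClassSpan)
open Literature.Barriers.HodgeConjecture (divisorClassesSpan)
open Literature.AlgebraicGeometry.ComplexMultiplication (IsCMTypeRealisation)

variable {K : Type} [Field K] [NumberField K] [IsCMField K]
  {A : AbelianVariety ℂ} {ι : 𝓞 K →+* End A} {θ : K →+* Module.End ℂ (complexBetti A.X 1)}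

/-! ## §0 The type read on the Galois group (tree dictionary, specialised to `ρ = conjGal`) -/

section GalType

variable [IsAbelianGalois ℚ K]

/-- `T = {g ∈ Gal(K/ℚ) : σ_g ∈ Φ}` is a CM type on the Galois group w.r.t. `ρ = conjGal` (tree
`CyclicTwoOddPrimes.isCMTypeWith_galType`). [cite: Kubota1965, §4 Lemma 2] [cite: Shimura1998, §18.2 Lemma (i)] -/
private theorem isCMTypeWith_conjGal_galType (Φ : CMType K) (φ₀ : K →+* ℂ) :
    IsCMTypeWith (conjGal : K ≃ₐ[ℚ] K)
      (↑(Finset.univ.filter fun s : K ≃ₐ[ℚ] K => embOf φ₀ s ∈ Φ.1) : Set (K ≃ₐ[ℚ] K)) :=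
  isCMTypeWith_galType (AbelianCMFieldExistence.apply_conjGal_eq φ₀) Φ

end GalType

variable [IsAbelianGalois ℚ K]

/-! ## §1 `B = D` on `A` iff the survivors form a coset in the character group -/

section Coset

/-- **`Bᵐ(A) ⊗ ℂ = Dᵐ(A) ⊗ ℂ` FOR ALL `m` IFF THE SURVIVORS FORM A COSET OF A SUBGROUP OF THE CHARACTER GROUP OF
`Gal(K/ℚ)`** (abelian CM field, any CM type, any abelian variety of the type): there are a subgroup `E ≤ Ĝ` and a
survivor `χ₀` with `χ ∈ S(Φ) ⟺ χ − χ₀ ∈ E`. [cite: Kubota1965, §2 and §4 Lemma 2] [cite: Pohlmann1968, Thm. 1]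
[cite: White1993SporadicCycles, §4 Theorem 3] [cite: Gordon1999HodgeAVSurvey, Thm. 6.4 and Prop. 9.4.1] -/
theorem forall_hodgeClassSpan_eq_iff_exists_addSubgroup (Φ : CMType K) (φ₀ : K →+* ℂ)
    (hA : IsCMTypeRealisation Φ A ι θ) :
    (∀ m : ℕ, hodgeClassSpan (finrank ℚ K / 2) A.X m = divisorClassesSpan A.X (finrank ℚ K / 2) m) ↔
      ∃ E : AddSubgroup (AddChar (Additive (K ≃ₐ[ℚ] K)) ℂ),
        ∃ χ₀ ∈ {χ : AddChar (Additive (K ≃ₐ[ℚ] K)) ℂ |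
            χ (Additive.ofMul (conjGal : K ≃ₐ[ℚ] K)) = -1 ∧
              ∑ s ∈ (Finset.univ.filter fun s : K ≃ₐ[ℚ] K => embOf φ₀ s ∈ Φ.1), χ (Additive.ofMul s) ≠ 0},
          ∀ χ : AddChar (Additive (K ≃ₐ[ℚ] K)) ℂ,
            χ ∈ {χ : AddChar (Additive (K ≃ₐ[ℚ] K)) ℂ |
                χ (Additive.ofMul (conjGal : K ≃ₐ[ℚ] K)) = -1 ∧
                  ∑ s ∈ (Finset.univ.filter fun s : K ≃ₐ[ℚ] K => embOf φ₀ s ∈ Φ.1), χ (Additive.ofMul s) ≠ 0} ↔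
              χ - χ₀ ∈ E := by
  rw [← two_mul_card_stabilizer_mul_eq_iff_forall_hodgeClassSpan_eq Φ φ₀ hA]
  exact two_mul_card_stabilizer_mul_eq_iff_exists_addSubgroup (isCMTypeWith_conjGal_galType Φ φ₀)

/-- **`B = D` on `A` iff `S(Φ) = χ₀ + (⟨S⟩ ∩ ker ρ)` for some survivor `χ₀`** (the explicit coset).
[cite: Kubota1965, §2 and §4 Lemma 2] [cite: White1993SporadicCycles, §4 Theorem 3] [cite: Gordon1999HodgeAVSurvey, Thm. 6.4] -/
theorem forall_hodgeClassSpan_eq_iff_forall_mem_iff_sub_mem (Φ : CMType K) (φ₀ : K →+* ℂ)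
    (hA : IsCMTypeRealisation Φ A ι θ) :
    (∀ m : ℕ, hodgeClassSpan (finrank ℚ K / 2) A.X m = divisorClassesSpan A.X (finrank ℚ K / 2) m) ↔
      ∃ χ₀ ∈ {χ : AddChar (Additive (K ≃ₐ[ℚ] K)) ℂ |
          χ (Additive.ofMul (conjGal : K ≃ₐ[ℚ] K)) = -1 ∧
            ∑ s ∈ (Finset.univ.filter fun s : K ≃ₐ[ℚ] K => embOf φ₀ s ∈ Φ.1), χ (Additive.ofMul s) ≠ 0},
        ∀ χ : AddChar (Additive (K ≃ₐ[ℚ] K)) ℂ,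
          χ ∈ {χ : AddChar (Additive (K ≃ₐ[ℚ] K)) ℂ |
              χ (Additive.ofMul (conjGal : K ≃ₐ[ℚ] K)) = -1 ∧
                ∑ s ∈ (Finset.univ.filter fun s : K ≃ₐ[ℚ] K => embOf φ₀ s ∈ Φ.1), χ (Additive.ofMul s) ≠ 0} ↔
            χ - χ₀ ∈ AddSubgroup.closure {χ : AddChar (Additive (K ≃ₐ[ℚ] K)) ℂ |
                χ (Additive.ofMul (conjGal : K ≃ₐ[ℚ] K)) = -1 ∧
                  ∑ s ∈ (Finset.univ.filter fun s : K ≃ₐ[ℚ] K => embOf φ₀ s ∈ Φ.1), χ (Additive.ofMul s) ≠ 0} ∧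
              (χ - χ₀) (Additive.ofMul (conjGal : K ≃ₐ[ℚ] K)) = 1 := by
  rw [← two_mul_card_stabilizer_mul_eq_iff_forall_hodgeClassSpan_eq Φ φ₀ hA]
  exact two_mul_card_stabilizer_mul_eq_iff_forall_mem_iff_sub_mem (isCMTypeWith_conjGal_galType Φ φ₀)

/-- **In the coset case `Rank(Φ) − 1 = |E|`.** [cite: Kubota1965, §4 Lemma 2] [cite: Gordon1999HodgeAVSurvey, Prop. 9.4.1] -/
theorem cmTypeRank_sub_one_eq_natCard_of_forall_mem_iff_sub_mem (Φ : CMType K) (φ₀ : K →+* ℂ)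
    (E : AddSubgroup (AddChar (Additive (K ≃ₐ[ℚ] K)) ℂ)) {χ₀ : AddChar (Additive (K ≃ₐ[ℚ] K)) ℂ}
    (hE : ∀ χ : AddChar (Additive (K ≃ₐ[ℚ] K)) ℂ,
      χ ∈ {χ : AddChar (Additive (K ≃ₐ[ℚ] K)) ℂ |
          χ (Additive.ofMul (conjGal : K ≃ₐ[ℚ] K)) = -1 ∧
            ∑ s ∈ (Finset.univ.filter fun s : K ≃ₐ[ℚ] K => embOf φ₀ s ∈ Φ.1), χ (Additive.ofMul s) ≠ 0} ↔
        χ - χ₀ ∈ E) :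
    cmTypeRank Φ - 1 = Nat.card E := by
  rw [cmTypeRank_eq_typeRank_galType Φ φ₀]
  exact typeRank_sub_one_eq_natCard_of_forall_mem_iff_sub_mem (isCMTypeWith_conjGal_galType Φ φ₀) E hE

/-- **A coset of survivors ⟹ the Hodge conjecture for every power `Aⁿ`.** [cite: Gordon1999HodgeAVSurvey, Thm. 6.4 and §9.3]
[cite: Kubota1965, §4 Lemma 2] -/
theorem hodgeConjectureFor_pow_of_forall_mem_iff_sub_mem (Φ : CMType K) (φ₀ : K →+* ℂ)
    (E : AddSubgroup (AddChar (Additive (K ≃ₐ[ℚ] K)) ℂ)) {χ₀ : AddChar (Additive (K ≃ₐ[ℚ] K)) ℂ}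
    (hχ₀ : χ₀ ∈ {χ : AddChar (Additive (K ≃ₐ[ℚ] K)) ℂ |
        χ (Additive.ofMul (conjGal : K ≃ₐ[ℚ] K)) = -1 ∧
          ∑ s ∈ (Finset.univ.filter fun s : K ≃ₐ[ℚ] K => embOf φ₀ s ∈ Φ.1), χ (Additive.ofMul s) ≠ 0})
    (hE : ∀ χ : AddChar (Additive (K ≃ₐ[ℚ] K)) ℂ,
      χ ∈ {χ : AddChar (Additive (K ≃ₐ[ℚ] K)) ℂ |
          χ (Additive.ofMul (conjGal : K ≃ₐ[ℚ] K)) = -1 ∧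
            ∑ s ∈ (Finset.univ.filter fun s : K ≃ₐ[ℚ] K => embOf φ₀ s ∈ Φ.1), χ (Additive.ofMul s) ≠ 0} ↔
        χ - χ₀ ∈ E)
    (hA : IsCMTypeRealisation Φ A ι θ) (n : ℕ) :
    HodgeConjectureFor (⨁ fun _ : Fin n => A).dim (⨁ fun _ : Fin n => A).X :=
  hodgeConjectureFor_pow_of_two_mul_natCard_twistStabilizer_mul_eq Φ
    ((two_mul_card_stabilizer_mul_eq_iff_two_mul_natCard_twistStabilizer_mul_eq Φ φ₀).1
      ((two_mul_card_stabilizer_mul_eq_iff_exists_addSubgroup (isCMTypeWith_conjGal_galType Φ φ₀)).2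
        ⟨E, χ₀, hχ₀, hE⟩)) hA n

end Coset

/-! ## §2 Galois conjugates and odd multiples of survivors -/

section Galois

/-- **A SURVIVOR WITH AN ANNIHILATED ODD MULTIPLE PRODUCES AN EXCEPTIONAL HODGE CLASS ON `A`**: `χ(ρ) = −1`,
`Σ_{t∈T} χ(t) ≠ 0` and `Σ_{t∈T} ((2k+1) • χ)(t) = 0`. [cite: Kubota1965, §2 and §4 Lemma 2] [cite: White1993SporadicCycles, §4 Theorem 3]
[cite: Gordon1999HodgeAVSurvey, Thm. 6.4 and §9.2] -/
theorem exists_exceptional_of_nsmul_sum_eq_zero (Φ : CMType K) (φ₀ : K →+* ℂ) (hA : IsCMTypeRealisation Φ A ι θ)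
    {χ : AddChar (Additive (K ≃ₐ[ℚ] K)) ℂ} (hρ : χ (Additive.ofMul (conjGal : K ≃ₐ[ℚ] K)) = -1)
    (hS : ∑ s ∈ (Finset.univ.filter fun s : K ≃ₐ[ℚ] K => embOf φ₀ s ∈ Φ.1), χ (Additive.ofMul s) ≠ 0)
    (k : ℕ) (h0 : ∑ s ∈ (Finset.univ.filter fun s : K ≃ₐ[ℚ] K => embOf φ₀ s ∈ Φ.1),
      ((2 * k + 1) • χ) (Additive.ofMul s) = 0) :
    ∃ m : ℕ, ∃ c : complexBetti A.X (2 * m), IsRationalClass c ∧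
      IsOfHodgeType (finrank ℚ K / 2) A.X (2 * m) m m c ∧ c ∉ divisorClassesSpan A.X (finrank ℚ K / 2) m := by
  rw [← two_mul_natCard_twistStabilizer_mul_lt_iff_exists_exceptional Φ hA,
    (two_mul_natCard_twistStabilizer_mul_cmTypeRank_sub_one_le Φ).lt_iff_ne, Ne,
    ← two_mul_card_stabilizer_mul_eq_iff_two_mul_natCard_twistStabilizer_mul_eq Φ φ₀]
  exact ne_of_lt (two_mul_card_stabilizer_mul_lt_of_nsmul_sum_eq_zero
    (isCMTypeWith_conjGal_galType Φ φ₀) hρ hS k h0)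

/-- **THE SURVIVORS ARE STABLE UNDER THE GALOIS ACTION `χ ↦ a • χ`, `a` coprime to `[K:ℚ]`.**
[cite: Dodson1984, §3.1.1] [cite: Ribet1980, §3] [cite: Kubota1965, §4 Lemma 2] -/
theorem nsmul_mem_survivors_iff (Φ : CMType K) (φ₀ : K →+* ℂ) {a : ℕ}
    (ha : a.Coprime (finrank ℚ K)) (χ : AddChar (Additive (K ≃ₐ[ℚ] K)) ℂ) :
    a • χ ∈ {χ : AddChar (Additive (K ≃ₐ[ℚ] K)) ℂ |
        χ (Additive.ofMul (conjGal : K ≃ₐ[ℚ] K)) = -1 ∧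
          ∑ s ∈ (Finset.univ.filter fun s : K ≃ₐ[ℚ] K => embOf φ₀ s ∈ Φ.1), χ (Additive.ofMul s) ≠ 0} ↔
      χ ∈ {χ : AddChar (Additive (K ≃ₐ[ℚ] K)) ℂ |
        χ (Additive.ofMul (conjGal : K ≃ₐ[ℚ] K)) = -1 ∧
          ∑ s ∈ (Finset.univ.filter fun s : K ≃ₐ[ℚ] K => embOf φ₀ s ∈ Φ.1), χ (Additive.ofMul s) ≠ 0} := by
  have ha' : a.Coprime (Fintype.card (K ≃ₐ[ℚ] K)) := by rwa [card_gal_eq_finrank φ₀]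
  exact Literature.NumberTheory.ComplexMultiplication.CyclicCMType.AbelianStabilizer.nsmul_mem_survivors_iff
    (isCMTypeWith_conjGal_galType Φ φ₀) ha' χ

/-- **`Rank(Φ) ≥ 1 + φ(ord χ)` FOR EVERY SURVIVOR `χ`** (abelian `K`, any CM type): the Galois conjugates of a
survivor are survivors. [cite: Kubota1965, §4 Lemma 2] [cite: Dodson1984, §3.1.1] [cite: Ribet1980, §3] -/
theorem one_add_totient_addOrderOf_le_cmTypeRank (Φ : CMType K) (φ₀ : K →+* ℂ)
    {χ : AddChar (Additive (K ≃ₐ[ℚ] K)) ℂ}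
    (hχ : χ ∈ {χ : AddChar (Additive (K ≃ₐ[ℚ] K)) ℂ |
        χ (Additive.ofMul (conjGal : K ≃ₐ[ℚ] K)) = -1 ∧
          ∑ s ∈ (Finset.univ.filter fun s : K ≃ₐ[ℚ] K => embOf φ₀ s ∈ Φ.1), χ (Additive.ofMul s) ≠ 0}) :
    1 + Nat.totient (addOrderOf χ) ≤ cmTypeRank Φ := by
  rw [cmTypeRank_eq_typeRank_galType Φ φ₀]
  exact one_add_totient_addOrderOf_le_typeRank (isCMTypeWith_conjGal_galType Φ φ₀) hχ

end Galois

end Literature.AlgebraicGeometry.Pohlmann1968
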